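import Summits.QuantumFields.YangMills.Theorems.BalabanUVNodesN07FlatHOfCoarseGradient
import HarnessLib

/-!
# DAG node N07 (road R0′, companion of `…N07FlatHOfCoarseGradient`) — FEASIBILITY OF THE PURE GAUGE FROM POSITIVITY, BY A
# DIMENSION COUNT: if `Δ_a` is positive on pure gauges (no non-constant `μ` with `∂_c(Eμ) = 0` and `R∂*∂μ = 0`) and the two
# constraint ranges together with the constants do not exceed `dim V`, then EVERY coarse datum `∂_cλ` in the range of `∂_c∘E`
# admits an admissible pure gauge `∂μ` — hence `H(∂_cλ) = ∂μ` (p607559) — hypothesis-form, abstract [B6] Sect. A carriers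

Width seat `pub-ymgap-dag-n07-w7` (g0), `--supports stmt-QuantumFields-20542 --as helper`; count-neutral; 0 `def`, 0 `sorry`.

WHY.  `…N07FlatHOfCoarseGradient` (§1″ `hOp_coarseGradient_eq_grad`) turns ONE admissible pure gauge at the datum `∂_cλ` into
`H(∂_cλ) = ∂μ`; its §2 supplies that pure gauge in print's MATCHED case (`Q∂ = ∂_cQ′` with the `Q′` of `R`).  At the RECORD the
(0.4) average intertwines gradients with the CENTRE VALUES `E` (`AlphaInputsT3ACv3AbelianLiftAvg.linAvg04_cobd`), not with the
block means behind `R`, and the located note `ROAD-CHECK-R4-R0prime.md` (B) reduced feasibility there to the positivity of `Δ_a` on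
pure gauges plus a count of dimensions («square coarse system: injectivity ⇔ surjectivity»).  THIS FILE types that reduction: the map
`T μ := (∂_c(Eμ), R∂*∂μ)` into `range(∂_c∘E) × range(R∂*∂)` has kernel EXACTLY `ker ∂` (positivity gives `⊆`, the intertwining
gives `⊇`), so by rank–nullity `T` is onto as soon as `dim range(∂_c∘E) + dim range(R∂*∂) + dim ker ∂ ≤ dim V` — on the lattice:
`(#coarse sites − 1) + (#fine sites − #coarse sites) + 1 = #fine sites`.

WHAT IS PROVED (namespace `Summit.QuantumFields.YangMills.Theorems.N07FlatHFeasibility`; carriers as in `B6Eq218Lagrangian` plus the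
coarse scalar module `Vc`, `dcoarse : Vc →ₗ W`, `E : V →ₗ Vc`).
* `ker_constraintMap_eq_ker_grad` (positivity on pure gauges + intertwining ⇒ the joint kernel of the two constraints is `ker ∂`),
* ★★ `exists_admissible_grad_of_flatKernel` (the dimension count ⇒ an admissible pure gauge at every `∂_cλ ∈ range(∂_c∘E)`),
* ★★ `hOp_coarseGradient_eq_grad_of_flatKernel` (∘ p607559: then `H(∂_cλ) = ∂μ` and `∂(H(∂_cλ)) = 0`).
* `hOp_datum_split` · `norm_hOp_datum_sub_eq` (linearity: `H(B″ + G_c + N) = HB″ + ∂μ + HN`, so only `‖HN‖` is priced by (46)).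
HONEST SCOPE.  Finite-dimensional linear algebra (rank–nullity); positivity, the dimension count and the intertwiner are DISPLAYED
hypotheses (at the record: the S4 lane's coercivity letter, lattice combinatorics, `linAvg04_cobd`); nothing of [B11] Sect. F's
analysis is asserted; N07 is not discharged; nothing here bears on the continuum, OS or the mass gap.

References: T. Bałaban, CMP **96** (1984) 223–250 [Balaban1984PropagatorsII] (2.9)–(2.12) p.225, (2.22) p.226, (2.35) p.228 («The only
assumption we have used was the positivity of the operator Δ_a»); CMP **102** (1985) 277–309 [Balaban1985Variational] (45)–(46) p.285.
-/

set_option autoImplicit false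

noncomputable section

open scoped InnerProductSpace

namespace Summit.QuantumFields.YangMills.Theorems.N07FlatHFeasibility

open Literature.MathematicalPhysics.QuantumFieldTheory.Balaban1983to89
open B6Eq218Lagrangian (Admissible IsCritical)
open N07FlatHOfCoarseGradient (admissible_grad_iff hOp_eq_grad_of_admissible_grad)

variable {P A V W Vc : Type*}
  [NormedAddCommGroup P] [InnerProductSpace ℝ P]
  [NormedAddCommGroup A] [InnerProductSpace ℝ A]
  [NormedAddCommGroup V] [InnerProductSpace ℝ V]
  [NormedAddCommGroup W] [InnerProductSpace ℝ W]
  [AddCommGroup Vc] [Module ℝ Vc]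

section Feasibility

variable (d : V →ₗ[ℝ] A) (dstar : A →ₗ[ℝ] V) (Rp : V →ₗ[ℝ] V) (Q : A →ₗ[ℝ] W) (dcoarse : Vc →ₗ[ℝ] W) (E : V →ₗ[ℝ] Vc)

/-- **The joint kernel of the two constraints on a pure gauge is `ker ∂`**: positivity of `Δ_a` on pure gauges
(`∂_c(Eμ) = 0 ∧ R∂*∂μ = 0 ⇒ ∂μ = 0`, [Balaban1984PropagatorsII] (2.22)) gives one inclusion, the intertwining `Q∂ = ∂_cE` the other.
[cite: Balaban1984PropagatorsII, (2.22) p.226, (2.35) p.228] -/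
theorem ker_constraintMap_eq_ker_grad (hQd : Q ∘ₗ d = dcoarse ∘ₗ E)
    (hker : ∀ μ : V, dcoarse (E μ) = 0 → Rp (dstar (d μ)) = 0 → d μ = 0) (μ : V) :
    (dcoarse (E μ) = 0 ∧ Rp (dstar (d μ)) = 0) ↔ d μ = 0 := by
  constructor
  · exact fun h => hker μ h.1 h.2
  · intro h
    have h1 : dcoarse (E μ) = Q (d μ) := by
      simpa only [LinearMap.coe_comp, Function.comp_apply] using (LinearMap.congr_fun hQd μ).symm
    refine ⟨?_, ?_⟩
    · rw [h1, h, map_zero]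
    · rw [h, map_zero, map_zero]

/-- ★★ **FEASIBILITY FROM POSITIVITY BY A DIMENSION COUNT.**  On a finite-dimensional `V`: if `Q∂ = ∂_cE`, `Δ_a` is positive on pure
gauges, and `dim range(∂_c∘E) + dim range(R∂*∂) + dim ker ∂ ≤ dim V` (on the lattice: `(#Λ′ − 1) + (#T − #Λ′) + 1 = #T`), then for
every `λ` with `∂_cλ ∈ range(∂_c∘E)` there is an ADMISSIBLE pure gauge `∂μ` at the datum `∂_cλ` (`∂_c(Eμ) = ∂_cλ`, `R∂*∂μ = 0`) —
the map `μ ↦ (∂_c(Eμ), R∂*∂μ)` has kernel `ker ∂` and is onto its natural codomain by rank–nullity.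
[cite: Balaban1984PropagatorsII, (2.9)-(2.12) p.225, (2.22) p.226, (2.35) p.228] -/
theorem exists_admissible_grad_of_flatKernel [FiniteDimensional ℝ V] (hQd : Q ∘ₗ d = dcoarse ∘ₗ E)
    (hker : ∀ μ : V, dcoarse (E μ) = 0 → Rp (dstar (d μ)) = 0 → d μ = 0)
    (hdim : Module.finrank ℝ (LinearMap.range (dcoarse ∘ₗ E)) + Module.finrank ℝ (LinearMap.range (Rp ∘ₗ dstar ∘ₗ d)) +
        Module.finrank ℝ (LinearMap.ker d) ≤ Module.finrank ℝ V)
    {lam : Vc} (hlam : dcoarse lam ∈ LinearMap.range (dcoarse ∘ₗ E)) :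
    ∃ μ : V, Admissible Q dstar Rp (dcoarse lam) (d μ) := by
  -- the constraint map into its natural codomain
  set T₁ : V →ₗ[ℝ] LinearMap.range (dcoarse ∘ₗ E) :=
    LinearMap.codRestrict _ (dcoarse ∘ₗ E) (fun c => LinearMap.mem_range_self _ c) with hT₁
  set T₂ : V →ₗ[ℝ] LinearMap.range (Rp ∘ₗ dstar ∘ₗ d) :=
    LinearMap.codRestrict _ (Rp ∘ₗ dstar ∘ₗ d) (fun c => LinearMap.mem_range_self _ c) with hT₂
  set T : V →ₗ[ℝ] LinearMap.range (dcoarse ∘ₗ E) × LinearMap.range (Rp ∘ₗ dstar ∘ₗ d) := T₁.prod T₂ with hT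
  -- the two components of `T`, definitionally
  have e1 : ∀ μ : V, (((T μ).1 : LinearMap.range (dcoarse ∘ₗ E)) : W) = dcoarse (E μ) := fun μ => rfl
  have e2 : ∀ μ : V, (((T μ).2 : LinearMap.range (Rp ∘ₗ dstar ∘ₗ d)) : V) = Rp (dstar (d μ)) := fun μ => rfl
  -- its kernel is `ker ∂`
  have hkerT : LinearMap.ker T = LinearMap.ker d := by
    ext μ
    rw [LinearMap.mem_ker, LinearMap.mem_ker, Prod.ext_iff, Subtype.ext_iff, Subtype.ext_iff, e1, e2]
    simp only [Prod.fst_zero, Prod.snd_zero, ZeroMemClass.coe_zero]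
    exact ker_constraintMap_eq_ker_grad d dstar Rp Q dcoarse E hQd hker μ
  -- rank–nullity: `T` is onto
  have hrank := LinearMap.finrank_range_add_finrank_ker T
  rw [hkerT] at hrank
  have hcod : Module.finrank ℝ (LinearMap.range (dcoarse ∘ₗ E) × LinearMap.range (Rp ∘ₗ dstar ∘ₗ d)) =
      Module.finrank ℝ (LinearMap.range (dcoarse ∘ₗ E)) + Module.finrank ℝ (LinearMap.range (Rp ∘ₗ dstar ∘ₗ d)) :=
    Module.finrank_prod
  have hle := Submodule.finrank_le (LinearMap.range T)
  have htop : LinearMap.range T = ⊤ := by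
    apply Submodule.eq_top_of_finrank_eq
    apply le_antisymm hle
    rw [hcod]
    omega
  -- hit the target `(∂_cλ, 0)`
  have hmem : ((⟨dcoarse lam, hlam⟩ : LinearMap.range (dcoarse ∘ₗ E)), (0 : LinearMap.range (Rp ∘ₗ dstar ∘ₗ d))) ∈
      LinearMap.range T := by
    rw [htop]; exact Submodule.mem_top
  obtain ⟨μ, hμ⟩ := LinearMap.mem_range.mp hmem
  refine ⟨μ, (admissible_grad_iff hQd lam μ).mpr ⟨?_, ?_⟩⟩
  · have h1 := congrArg (fun z => ((z.1 : LinearMap.range (dcoarse ∘ₗ E)) : W)) hμ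
    simp only [e1] at h1
    exact h1
  · have h2 := congrArg (fun z => ((z.2 : LinearMap.range (Rp ∘ₗ dstar ∘ₗ d)) : V)) hμ
    simp only [e2, ZeroMemClass.coe_zero] at h2
    exact h2

end Feasibility

section HOp

variable (ΔA : A →ₗ[ℝ] A) (a : W →ₗ[ℝ] W) (dc : A →ₗ[ℝ] P) (dcs : P →ₗ[ℝ] A) (d : V →ₗ[ℝ] A)
  (dstar : A →ₗ[ℝ] V) (Rp : V →ₗ[ℝ] V) (Q : A →ₗ[ℝ] W) (Qs : W →ₗ[ℝ] A)

/-- ★★ **`H(∂_cλ) = ∂μ` FROM POSITIVITY ALONE (plus the count)**: with the inputs of `B6Eq218Lagrangian.isCritical_unique`,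
`∂∂ = 0`, the intertwiner `Q∂ = ∂_cE`, positivity of `Δ_a` on pure gauges and the dimension count, print's `H` sends every datum
`∂_cλ ∈ range(∂_c∘E)` to a fine pure gauge. [cite: Balaban1984PropagatorsII, (2.22) p.226, (2.35) p.228; Balaban1985Variational, (45)-(46) p.285] -/
theorem hOp_coarseGradient_eq_grad_of_flatKernel [FiniteDimensional ℝ A] [FiniteDimensional ℝ V]
    (hΔa : ΔA = dcs ∘ₗ dc + d ∘ₗ Rp ∘ₗ dstar + Qs ∘ₗ a ∘ₗ Q)
    (hdc : ∀ (p : P) (x : A), ⟪dcs p, x⟫_ℝ = ⟪p, dc x⟫_ℝ)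
    (hd : ∀ (v : V) (x : A), ⟪d v, x⟫_ℝ = ⟪v, dstar x⟫_ℝ) (hR : ∀ u v : V, ⟪Rp u, v⟫_ℝ = ⟪u, Rp v⟫_ℝ)
    (hRR : Rp ∘ₗ Rp = Rp) (hQ : ∀ (w : W) (x : A), ⟪Qs w, x⟫_ℝ = ⟪w, Q x⟫_ℝ)
    (G : A →ₗ[ℝ] A) (Einv : W →ₗ[ℝ] W) (hG : G ∘ₗ ΔA = LinearMap.id)
    (h231 : Rp ∘ₗ dstar ∘ₗ G ∘ₗ d ∘ₗ Rp = Rp) (h234 : Rp ∘ₗ dstar ∘ₗ G ∘ₗ Qs = 0)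
    (hE : Einv ∘ₗ (Q ∘ₗ G ∘ₗ Qs) = LinearMap.id)
    (hdcd : dc ∘ₗ d = 0) (dcoarse : Vc →ₗ[ℝ] W) (E : V →ₗ[ℝ] Vc) (hQd : Q ∘ₗ d = dcoarse ∘ₗ E)
    (hker : ∀ μ : V, dcoarse (E μ) = 0 → Rp (dstar (d μ)) = 0 → d μ = 0)
    (hdim : Module.finrank ℝ (LinearMap.range (dcoarse ∘ₗ E)) + Module.finrank ℝ (LinearMap.range (Rp ∘ₗ dstar ∘ₗ d)) +
        Module.finrank ℝ (LinearMap.ker d) ≤ Module.finrank ℝ V)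
    {lam : Vc} (hlam : dcoarse lam ∈ LinearMap.range (dcoarse ∘ₗ E)) :
    ∃ μ : V, B6SectA.hOp G Qs Einv (dcoarse lam) = d μ ∧ dc (B6SectA.hOp G Qs Einv (dcoarse lam)) = 0 := by
  obtain ⟨μ, hμ⟩ := exists_admissible_grad_of_flatKernel d dstar Rp Q dcoarse E hQd hker hdim hlam
  have h := hOp_eq_grad_of_admissible_grad ΔA a dc dcs d dstar Rp Q Qs hΔa hdc hd hR hRR hQ G Einv hG h231 h234 hE
    hdcd hμ
  exact ⟨μ, h, by rw [h]; simpa using LinearMap.congr_fun hdcd μ⟩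

end HOp

section Split

variable {dc : A →ₗ[ℝ] P} {Q : A →ₗ[ℝ] W} {dstar : A →ₗ[ℝ] V} {Rp : V →ₗ[ℝ] V} {d : V →ₗ[ℝ] A}

/-- **The R0′ split through `H`** (linearity + the pure-gauge row): if the sheared datum splits as `B‴ = B″ + G_c + N` with `G_c`
a coarse pure gauge that `H` sends to the fine pure gauge `∂μ` (p607559 ∕ this file) and `N` the BCH remainder (this seat's
`…N07ShearDatumBCH`), then `HB‴ = HB″ + ∂μ + HN` — the shear enters the potential as a pure gauge plus `H` of a quadratic remainder.
[cite: Balaban1985Variational, (45)-(46) p.285, (157) p.302, (164) p.303] -/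
theorem hOp_datum_split (H : W →ₗ[ℝ] A) {B'' Gc N : W} {μ : V} (hG : H Gc = d μ) :
    H (B'' + Gc + N) = H B'' + d μ + H N := by
  rw [map_add, map_add, hG]

/-- … and the norm of the shift beyond the pure gauge is controlled by `‖H N‖` alone: `‖HB‴ − (HB″ + ∂μ)‖ = ‖HN‖` (so (46)
`|HB| ≤ B₀|B|` prices only the quadratic remainder). [cite: Balaban1985Variational, (46) p.285, (164) p.303] -/
theorem norm_hOp_datum_sub_eq (H : W →ₗ[ℝ] A) {B'' Gc N : W} {μ : V} (hG : H Gc = d μ) :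
    ‖H (B'' + Gc + N) - (H B'' + d μ)‖ = ‖H N‖ := by
  rw [hOp_datum_split H hG, add_sub_cancel_left]

end Split

end Summit.QuantumFields.YangMills.Theorems.N07FlatHFeasibility

end
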